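import Summits.BirchSwinnertonDyer.BirchSwinnertonDyer.Theorems.ManinLocalTwoThreeSigmaSquareRootMonodromy
import Summits.BirchSwinnertonDyer.BirchSwinnertonDyer.Theorems.ManinLocalTwoThreeKummerSquareAnalyticDictionary
import Summits.BirchSwinnertonDyer.BirchSwinnertonDyer.Theorems.ManinLocalTwoThreeQExpansionPowerIdentityPrinciple
import Literature.NumberTheory.EllipticCurves.PeriodLatticeLevelRaisingProofs
import HarnessLib

/-!
# The Kummer SQUARE series of a rational `2`-torsion point is NOT a square in `K_{mN}` (`m ∣ N`) — the `p = 2` twin of P79/G0, UNCONDITIONAL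
# (route `ManinLocalTwoThree`, crux C2 `ManinOddAtFour` stmt-BirchSwinnertonDyer-22967; cell bsd-f2-manin, p2 gen 16; assembled from the `p = 2` leaves
# S1₂ `kummerSquareAnalyticDictionary` (p722831), S2₂ `qExpansion_sq_identity_principle` (p722755), S3₂/S3b₂/S6₂ (`…SigmaSquareRootLeaves`, p722544),
# S4₂ `sigmaSqRootMonodromy` (`…SigmaSquareRootMonodromy`) and the tree's level-raising closure S5 `le_closure_smul_cuspSymbol_image_level_mul`
# (p718813), exactly as `KummerCubeMonodromy.kummerCubeSeries_not_cube_of_level_mul` assembles the `p = 3` leaves)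

* `kummerSeries_not_sq_of_level_mul`: for an `X₀(N)`-parametrisation datum `D` of `W` satisfying the LATTICE CLAUSE `Λ_W ⊆ c·Λ_f`
  (optimality), `m ∣ N`, THE formal germ `z` (`IsParamGerm W c a z`) and a rational root `x₀` of the `2`-division cubic
  `4x³ + b₂x² + 2b₄x + b₆` of `W`, the Kummer square series `Ξ_T = kummerSeries W c x₀ z` (`= z²·(x∘φ − x(T))` on the short model) is not
  the square of an element of the modular function field `K_{mN}` (as Laurent `q`-series).
* `kummerSeries_not_sq_at_level` (`m = 1`), `kummerSeries_not_sq_at_four_mul` (`m = 4`, `4 ∣ N`).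
Proof: a square root `u = F̂/Ĝ ∈ K_{mN}` gives `F̂² = Ξ·Ĝ²`, hence (S1₂ + S2₂) `F² = t_s²(x_s − e_s)·G²` near `i∞`; by S6₂ `e_s = c²℘(a)` with
`2a ∈ Λ ∌ a`, by S3₂ `x_s − e_s = c²·C·V(w)²`, so `F² = (c²C)·(t_s·V(w))²·G²` and S4₂ makes `V` periodic under `c·{∞, γ∞}_f` for all
`γ ∈ Γ₀(mN)`; these generate (S5 + the lattice clause) a group containing `Λ`, contradicting S3b₂.  `c ≠ 0` follows from the lattice clause.
HONEST FRAMING: this is the GEOMETRIC half only («`φ^*[(T) − (O)] ≠ 0` in `J₀(mN)`, analytically»); the ARITHMETIC half of C2 v21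
`stub_cuspidalKummerOddExponentOnCore` (E-an-53: «all `η`-exponents even ⟹ `Ξ_T` IS such a square», the `2`-adic `η`-descent) is NOT here and is the
planners' to type; nothing about BSD or Manin's conjecture is proved; C2 remains OPEN.
[cite: Manin1972, Thm. 1.9 (shape)] [cite: SilvermanAEC2009, III.8 (Weil pairing via σ; shape)]
-/

set_option autoImplicit false
-- lint-debt: the directory name repeats the summit name (sibling precedent `ManinLocalTwoThreeKummerCubeMonodromy.lean`)
set_option linter.dupNamespace false

noncomputable section

open PowerSeries CongruenceSubgroup Complex
open scoped MatrixGroups ModularForm PeriodPair UpperHalfPlane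
open WeierstrassCurve Literature.NumberTheory.EllipticCurves Literature.NumberTheory.EllipticCurves.ModularForms
open Summit.BirchSwinnertonDyer.Rank1Residual.ManinAdditive.CuspidalKummer
open Summit.BirchSwinnertonDyer.Rank1Residual.ManinAdditive.KummerCubeMonodromy
open Summit.BirchSwinnertonDyer.BirchSwinnertonDyer.Theorems.ManinLocalTwoThree.KummerCubeSigmaLeaves
open Summit.BirchSwinnertonDyer.BirchSwinnertonDyer.Theorems.ManinLocalTwoThree.KummerCubeAnalytic

namespace Summit.BirchSwinnertonDyer.BirchSwinnertonDyer.Theorems.ManinLocalTwoThree.SigmaSquareRoot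

/-- **The level-uniform square-root monodromy theorem (unconditional).**  For `m ∣ N`, a datum with the lattice clause, THE formal
germ `z` and a rational `2`-division root `x₀`: `Ξ_T ∉ (K_{mN})²`.  [cite: Manin1972, Thm. 1.9 (shape; the composition is the cell's)] -/
theorem kummerSeries_not_sq_of_level_mul
    (W : WeierstrassCurve ℚ) [W.IsElliptic] [W.IsGloballyMinimal] {N : ℕ} [NeZero N]
    (D : ModularParametrizationData W N) (a : ℕ → ℤ) (ha : ∀ n, (a n : ℂ) = cuspCoeff D.f n)
    {m : ℕ} [NeZero (m * N)] (hm : m ∣ N) (hLat : ∀ z ∈ D.L.lattice, ∃ w ∈ periodLattice D.f, z = D.c * w)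
    {x₀ : ℚ} (hx : W.twoTorsionPolynomial.toPoly.IsRoot x₀) (z : ℚ⟦X⟧) (hz : IsParamGerm W D.c a z)
    (u : LaurentSeries ℂ) (hu : u ∈ modularFunctionField (m * N)) :
    HahnSeries.ofPowerSeries ℤ ℂ ((kummerSeries W D.c x₀ z).map (algebraMap ℚ ℂ)) ≠ u ^ 2 := by
  intro hsq
  -- `c ≠ 0` from the lattice clause (`Λ ≠ 0`)
  have hc0 : D.c ≠ 0 := by
    intro h0
    obtain ⟨w, -, hw⟩ := hLat _ D.L.ω₁_mem_lattice
    rw [h0, Int.cast_zero, zero_mul] at hw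
    exact (by simpa using D.L.indep.ne_zero 0 : D.L.ω₁ ≠ 0) hw
  have hc0' : (D.c : ℂ) ≠ 0 := Int.cast_ne_zero.mpr hc0
  -- S6₂: the torsion abscissa is `c²℘(p)`, `2p ∈ Λ ∌ p`
  obtain ⟨p, hpΛ, h2p, h℘p⟩ := exists_halfPeriod_of_twoTorsion_root D hx
  have hX : ((shortRoot W D.c x₀ : ℚ) : ℂ) = (D.c : ℂ) ^ 2 * ℘[D.L] p := shortRoot_eq_of_weierstrassP_eq W D.c h℘p
  obtain ⟨m₁, m₂, hm12⟩ := PeriodPair.mem_lattice.mp h2p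
  -- the representation `u = F̂/Ĝ` and the power-series identity `F̂² = Ξ·Ĝ²`
  obtain ⟨k, F, G, hG, hFG⟩ := (mem_modularFunctionField_iff (N := m * N)).mp hu
  set Θc : PowerSeries ℂ := (kummerSeries W D.c x₀ z).map (algebraMap ℚ ℂ) with hΘc
  have hPS : UpperHalfPlane.qExpansion 1 ⇑F ^ 2 = Θc * UpperHalfPlane.qExpansion 1 ⇑G ^ 2 := by
    apply HahnSeries.ofPowerSeries_injective (Γ := ℤ) (R := ℂ)
    rw [map_pow, map_mul, map_pow, ← qExpansionL_def, ← qExpansionL_def, ← hFG, hsq]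
    ring
  -- S1₂ + S2₂: `F² = Ξ^an·G²` near `i∞`
  obtain ⟨B, hB⟩ := kummerSquareAnalyticDictionary W D a ha hc0 x₀ z hz
  have hcoef : ∀ τ : ℍ, B < τ.im →
      HasSum (fun n : ℕ ↦ coeff n Θc * Function.Periodic.qParam 1 (τ : ℂ) ^ n)
        (shortT D τ ^ 2 * (shortX D τ - ((shortRoot W D.c x₀ : ℚ) : ℂ))) := by
    intro τ hτ
    have h := hB τ hτ
    simp only [hΘc, PowerSeries.coeff_map, eq_ratCast]
    exact h
  have hFG2 := qExpansion_sq_identity_principle (m * N) k F G Θc _ B hcoef hPS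
  -- S3₂: `x − x(T) = C·V²`
  obtain ⟨C, hC0, hV⟩ := exists_weierstrassP_sub_eq_mul_sigmaSqRoot_sq D.L hpΛ hm12.symm
  set e : ℂ := m₁ * D.L.η₁ + m₂ * D.L.η₂ with he
  -- the hypothesis of S4₂ with the constant `c²·C`
  have hS4 : ∀ τ : ℍ, B < τ.im → (D.c : ℂ) * eichlerIntegral D.f τ ∉ D.L.lattice →
      F τ ^ 2 = (D.c : ℂ) ^ 2 * C *
        (shortT D τ * sigmaSqRoot D.L p e ((D.c : ℂ) * eichlerIntegral D.f τ)) ^ 2 * G τ ^ 2 := by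
    intro τ hτ hw
    rw [hFG2 τ hτ, hX, shortX, ← mul_sub, hV _ hw]
    ring
  -- S4₂: monodromy
  have hper := sigmaSqRootMonodromy W D p e (m * N) k F G ((D.c : ℂ) ^ 2 * C) B (dvd_mul_left N m) hG
    (mul_ne_zero (pow_ne_zero 2 hc0') hC0) hS4
  -- the stabiliser of `V_p` is a subgroup containing the scaled periods over `Γ₀(N) ∩ Γ₀(mN)`, hence `Λ` (S5 + clause)
  let S : AddSubgroup ℂ :=
    { carrier := {l : ℂ | ∀ w₀ : ℂ, sigmaSqRoot D.L p e (w₀ + l) = sigmaSqRoot D.L p e w₀}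
      zero_mem' := fun w₀ ↦ by rw [add_zero]
      add_mem' := fun {l₁ l₂} hl₁ hl₂ w₀ ↦ by rw [← add_assoc, hl₂, hl₁]
      neg_mem' := fun {l} hl w₀ ↦ by
        have h := hl (w₀ + -l)
        rw [neg_add_cancel_right] at h
        exact h.symm }
  have hgen : (fun δ : Gamma0 N ↦ (D.c : ℂ) * cuspSymbol D.f δ) '' {δ : Gamma0 N | (δ : SL(2, ℤ)) ∈ Gamma0 (m * N)}
      ⊆ (S : Set ℂ) := by
    rintro _ ⟨δ, hδ, rfl⟩ w₀
    exact hper δ hδ w₀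
  have hΛS : ∀ l ∈ D.L.lattice, l ∈ S := by
    intro l hl
    have hle := le_closure_smul_cuspSymbol_image_level_mul D.f hm (D.c : ℂ) D.L.lattice.toAddSubgroup
      (fun z hz ↦ hLat z hz)
    exact (AddSubgroup.closure_le S).mpr hgen (hle hl)
  -- S3b₂: but `V_p` is not `Λ`-periodic
  obtain ⟨ω, hω, w, hne⟩ := sigmaSqRoot_not_periodic D.L hpΛ hm12.symm
  exact hne (hΛS ω hω w)

/-- **At level `N` itself** (`m = 1`): `Ξ_T` is not a square in `K_N`. [cite: Manin1972, Thm. 1.9 (shape)] -/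
theorem kummerSeries_not_sq_at_level
    (W : WeierstrassCurve ℚ) [W.IsElliptic] [W.IsGloballyMinimal] {N : ℕ} [NeZero N]
    (D : ModularParametrizationData W N) (a : ℕ → ℤ) (ha : ∀ n, (a n : ℂ) = cuspCoeff D.f n)
    (hLat : ∀ z ∈ D.L.lattice, ∃ w ∈ periodLattice D.f, z = D.c * w)
    {x₀ : ℚ} (hx : W.twoTorsionPolynomial.toPoly.IsRoot x₀) (z : ℚ⟦X⟧) (hz : IsParamGerm W D.c a z)
    (u : LaurentSeries ℂ) (hu : u ∈ modularFunctionField N) :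
    HahnSeries.ofPowerSeries ℤ ℂ ((kummerSeries W D.c x₀ z).map (algebraMap ℚ ℂ)) ≠ u ^ 2 := by
  haveI : NeZero (1 * N) := ⟨by simpa using NeZero.ne N⟩
  exact kummerSeries_not_sq_of_level_mul W D a ha (m := 1) (one_dvd N) hLat hx z hz u (by simpa using hu)

/-- **At level `4N`** (`m = 4`, `4 ∣ N` — the C2 regime): `Ξ_T` is not a square in `K_{4N}`. [cite: Manin1972, Thm. 1.9 (shape)] -/
theorem kummerSeries_not_sq_at_four_mul
    (W : WeierstrassCurve ℚ) [W.IsElliptic] [W.IsGloballyMinimal] {N : ℕ} [NeZero N]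
    (D : ModularParametrizationData W N) (a : ℕ → ℤ) (ha : ∀ n, (a n : ℂ) = cuspCoeff D.f n)
    (h4 : 4 ∣ N) (hLat : ∀ z ∈ D.L.lattice, ∃ w ∈ periodLattice D.f, z = D.c * w)
    {x₀ : ℚ} (hx : W.twoTorsionPolynomial.toPoly.IsRoot x₀) (z : ℚ⟦X⟧) (hz : IsParamGerm W D.c a z)
    (u : LaurentSeries ℂ) (hu : u ∈ modularFunctionField (4 * N)) :
    HahnSeries.ofPowerSeries ℤ ℂ ((kummerSeries W D.c x₀ z).map (algebraMap ℚ ℂ)) ≠ u ^ 2 := by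
  haveI : NeZero (4 * N) := ⟨mul_ne_zero (by norm_num) (NeZero.ne N)⟩
  exact kummerSeries_not_sq_of_level_mul W D a ha (m := 4) h4 hLat hx z hz u hu

end Summit.BirchSwinnertonDyer.BirchSwinnertonDyer.Theorems.ManinLocalTwoThree.SigmaSquareRoot

end
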